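import Summits.HodgeConjecture.HodgeConjecture.Theorems.TropicalWeilObstructionTropicalHodgeBoundChkCore

/-!
# Crux `TropicalHodgeBound` (stmt-HodgeConjecture-18480), stub 4 — part C2: soundness of the certificate
# checker (the linear-algebra layer)

Route `TropicalWeilObstruction` of `HodgeConjecture`, registered line `birth`
(`Cruxes/TropicalHodgeBound/Lines/birth.lean`), stub `stub_rationalHodgeCoordinates`; ingredient (C).

For an arbitrary valuation `yv : ℕ → ℤ` of the unknown codes, this file proves that the checker of
`…ChkCore` only ever records TRUE linear facts: if every equation fed to a chunk evaluates to `0` under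
`yv` and the incoming boundary facts hold, then (`checkChunk_sound`) the outgoing boundary facts hold and
every unknown `u` in the chunk's final list satisfies the resolved relation
`yv u = B₀(u) · (yv 0 + yv 14) - B₁(u) · yv 14 - B₂(u) · yv 4` (`relRHS`), `B(u) = basisN` the integer
values of `(θ₄, Re w, Im w)` at `u`. Ingredients: the value `evalL` of an integer combination is additive
under `addTerm`/`mergeL`/`scaleL`/`eraseKey`; a sound table stays sound under `doStep` (the reduced
equation is a consequence of the equation and the recorded facts); `reduce` preserves
`mult · E = Σ row`; `finalOne` then pins `yv u` down. Which equations hold (the coefficient equations of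
`…Genericity`) is the subject of `…CheckerEquations`. No named fact, no sorry.

References: [Zharkov2020TropicalWeil] I. Zharkov, arXiv:2002.02347, §2; [MikhalkinZharkov2014Eigenwave]
G. Mikhalkin, I. Zharkov, LN UMI 15 (2014), Thm. 5.4.
-/

set_option linter.dupNamespace false

namespace Summit.HodgeConjecture.HodgeConjecture.Theorems.TropicalHodgeBound

namespace Chk

section Sound

variable (yv : ℕ → ℤ)

/-- The value of an integer combination of unknowns under the valuation `yv`. [folklore] -/
def evalL (l : List (ℕ × ℤ)) : ℤ := (l.map fun p => p.2 * yv p.1).sum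

/-- `evalL` of the empty combination. [folklore] -/
@[simp] theorem evalL_nil : evalL yv [] = 0 := rfl

/-- `evalL` of a cons. [folklore] -/
@[simp] theorem evalL_cons (p : ℕ × ℤ) (l : List (ℕ × ℤ)) :
    evalL yv (p :: l) = p.2 * yv p.1 + evalL yv l := by
  simp [evalL]

/-- `evalL` is additive under concatenation. [folklore] -/
@[simp] theorem evalL_append (l₁ l₂ : List (ℕ × ℤ)) :
    evalL yv (l₁ ++ l₂) = evalL yv l₁ + evalL yv l₂ := by
  simp [evalL, List.sum_append]

/-- `evalL` of a scaled combination. [folklore] -/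
theorem evalL_scaleL (k : ℤ) (l : List (ℕ × ℤ)) : evalL yv (scaleL k l) = k * evalL yv l := by
  induction l with
  | nil => simp [scaleL]
  | cons p l ih =>
      simp only [scaleL, List.map_cons, evalL_cons] at *
      rw [ih]; ring

/-- `evalL` after adding a term. [folklore] -/
theorem evalL_addTerm (l : List (ℕ × ℤ)) (p : ℕ × ℤ) :
    evalL yv (addTerm l p) = evalL yv l + p.2 * yv p.1 := by
  induction l with
  | nil =>
      rcases p with ⟨u, c⟩
      by_cases hc : c = 0
      · simp [addTerm, hc]
      · simp [addTerm, hc]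
  | cons q l ih =>
      rcases p with ⟨u, c⟩
      rcases q with ⟨v, a⟩
      by_cases hv : v = u
      · subst hv
        by_cases hac : a + c = 0
        · simp only [addTerm, if_true, hac, evalL_cons]
          have : c = -a := by linarith
          rw [this]; ring
        · simp only [addTerm, if_true, hac, if_false, evalL_cons]
          ring
      · simp only [addTerm, hv, if_false, evalL_cons]
        rw [ih]; ring

/-- `evalL` of a merge is the sum. [folklore] -/
theorem evalL_mergeL (l₁ l₂ : List (ℕ × ℤ)) :
    evalL yv (mergeL l₁ l₂) = evalL yv l₁ + evalL yv l₂ := by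
  unfold mergeL
  induction l₂ generalizing l₁ with
  | nil => simp
  | cons p l ih =>
      rw [List.foldl_cons, ih, evalL_addTerm, evalL_cons]
      ring

/-- `coefOf` of a cons with the same key. [folklore] -/
theorem coefOf_cons_eq (a : ℤ) (l : List (ℕ × ℤ)) (u : ℕ) : coefOf ((u, a) :: l) u = a + coefOf l u := by
  simp [coefOf]

/-- `coefOf` of a cons with a different key. [folklore] -/
theorem coefOf_cons_ne {v u : ℕ} (h : v ≠ u) (a : ℤ) (l : List (ℕ × ℤ)) :
    coefOf ((v, a) :: l) u = coefOf l u := by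
  simp [coefOf, h]

/-- `eraseKey` of a cons with the same key. [folklore] -/
theorem eraseKey_cons_eq (a : ℤ) (l : List (ℕ × ℤ)) (u : ℕ) : eraseKey ((u, a) :: l) u = eraseKey l u := by
  simp [eraseKey]

/-- `eraseKey` of a cons with a different key. [folklore] -/
theorem eraseKey_cons_ne {v u : ℕ} (h : v ≠ u) (a : ℤ) (l : List (ℕ × ℤ)) :
    eraseKey ((v, a) :: l) u = (v, a) :: eraseKey l u := by
  simp [eraseKey, h]

/-- Splitting off the unknown `u`: `Σ l = coefOf l u · yv u + Σ (l without u)`. [folklore] -/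
theorem evalL_eraseKey (l : List (ℕ × ℤ)) (u : ℕ) :
    evalL yv l = coefOf l u * yv u + evalL yv (eraseKey l u) := by
  induction l with
  | nil => simp [coefOf, eraseKey]
  | cons p l ih =>
      rcases p with ⟨v, a⟩
      by_cases hv : v = u
      · subst hv
        rw [coefOf_cons_eq, eraseKey_cons_eq, evalL_cons, ih]; ring
      · rw [coefOf_cons_ne hv, eraseKey_cons_ne hv, evalL_cons, evalL_cons, ih]; ring

/-- A combination supported on the unknowns `0, 4, 14` evaluates through its three coefficients.
[folklore] -/
theorem evalL_of_support (l : List (ℕ × ℤ)) (h : ∀ q ∈ l, q.1 = 0 ∨ q.1 = 4 ∨ q.1 = 14) :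
    evalL yv l = coefOf l 0 * yv 0 + coefOf l 4 * yv 4 + coefOf l 14 * yv 14 := by
  induction l with
  | nil => simp [coefOf]
  | cons p l ih =>
      have hl : ∀ q ∈ l, q.1 = 0 ∨ q.1 = 4 ∨ q.1 = 14 := fun q hq => h q (List.mem_cons_of_mem _ hq)
      rcases p with ⟨v, a⟩
      rw [evalL_cons, ih hl]
      rcases h (v, a) (List.mem_cons_self) with hv | hv | hv <;> simp only at hv <;> subst hv <;>
        simp [coefOf] <;> ring

/-! ### Sound tables -/

/-- `getD` is unchanged by `set` at another index. [folklore] -/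
theorem getD_set_ne {α : Type*} : ∀ (l : List α) (i j : ℕ) (a d : α), i ≠ j →
    (l.set i a).getD j d = l.getD j d
  | [], i, j, a, d, _ => by simp
  | x :: l, 0, 0, a, d, h => absurd rfl h
  | x :: l, 0, j + 1, a, d, _ => by simp
  | x :: l, i + 1, 0, a, d, _ => by simp
  | x :: l, i + 1, j + 1, a, d, h => by
      simp only [List.set_cons_succ, List.getD_cons_succ]
      exact getD_set_ne l i j a d (fun e => h (by rw [e]))

/-- `getD` at the index of `set`: the new value (in range) or the default (out of range, where `set`
does nothing). [folklore] -/
theorem getD_set_self {α : Type*} : ∀ (l : List α) (i : ℕ) (a d : α),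
    (l.set i a).getD i d = a ∨ ((l.set i a).getD i d = l.getD i d)
  | [], i, a, d => by simp
  | x :: l, 0, a, d => by simp
  | x :: l, i + 1, a, d => by
      simp only [List.set_cons_succ, List.getD_cons_succ]
      exact getD_set_self l i a d

/-- `getD` on a constant list. [folklore] -/
theorem getD_replicate {α : Type*} : ∀ (n i : ℕ) (a d : α),
    (List.replicate n a).getD i d = if i < n then a else d
  | 0, i, a, d => by simp
  | n + 1, 0, a, d => by simp
  | n + 1, i + 1, a, d => by
      rw [List.replicate_succ, List.getD_cons_succ, getD_replicate n i a d]
      by_cases h : i < n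
      · rw [if_pos h, if_pos (by omega)]
      · rw [if_neg h, if_neg (by omega)]

/-- The empty table is sound. [folklore] -/
theorem emptyTable_sound :
    ∀ u f, Table.get emptyTable u = some f → f.1 * yv u = evalL yv f.2 := by
  intro u f h
  exfalso
  unfold Table.get emptyTable at h
  rw [getD_replicate] at h
  split_ifs at h with h1
  · rw [getD_replicate] at h
    split_ifs at h
  · simp at h

/-- Reading back after recording: either the new fact at the same unknown, or an old one. [folklore] -/
theorem Table.get_set (t : Table) (u v : ℕ) (f g : Fact) (h : (t.set u f).get v = some g) :
    (v = u ∧ g = f) ∨ t.get v = some g := by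
  unfold Table.get Table.set at h
  unfold Table.get
  by_cases hr : u / 70 = v / 70
  · rw [← hr] at h ⊢
    rcases getD_set_self t (u / 70) ((t.getD (u / 70) []).set (u % 70) (some f)) [] with e | e
    · rw [e] at h
      by_cases hc : u % 70 = v % 70
      · rw [← hc] at h ⊢
        rcases getD_set_self (t.getD (u / 70) []) (u % 70) (some f) none with e2 | e2
        · rw [e2] at h
          left
          refine ⟨?_, by simpa using h.symm⟩
          have := Nat.div_add_mod v 70
          have := Nat.div_add_mod u 70
          omega
        · rw [e2] at h; right; exact h
      · rw [getD_set_ne _ _ _ _ _ hc] at h; right; exact h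
    · rw [e] at h; right; exact h
  · rw [getD_set_ne _ _ _ _ _ hr] at h; right; exact h

/-- Recording a true fact keeps a table sound. [folklore] -/
theorem Table.sound_set {t : Table} (ht : ∀ u f, Table.get t u = some f → f.1 * yv u = evalL yv f.2)
    (u : ℕ) (f : Fact) (hf : f.1 * yv u = evalL yv f.2) :
    ∀ v g, Table.get (t.set u f) v = some g → g.1 * yv v = evalL yv g.2 := by
  intro v g hg
  rcases Table.get_set t u v f g hg with ⟨hv, hgf⟩ | h
  · subst hv; subst hgf; exact hf
  · exact ht v g h

/-- `findFact` returns a recorded fact. [folklore] -/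
theorem findFact_get (t : Table) : ∀ (row : List (ℕ × ℤ)) (u : ℕ) (f : Fact),
    findFact t row = some (u, f) → t.get u = some f
  | [], u, f, h => by simp [findFact] at h
  | (v, a) :: l, u, f, h => by
      unfold findFact at h
      cases hv : t.get v with
      | none => rw [hv] at h; exact findFact_get t l u f h
      | some g => rw [hv] at h; simp only [Option.some.injEq, Prod.mk.injEq] at h; rw [← h.1, ← h.2]; exact hv

/-- `reduce` preserves the invariant `mult · E = Σ row` on a sound table. [folklore] -/
theorem reduce_sound {t : Table} (ht : ∀ u f, Table.get t u = some f → f.1 * yv u = evalL yv f.2)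
    (E : ℤ) :
    ∀ (n : ℕ) (x : ℤ × List (ℕ × ℤ)), x.1 * E = evalL yv x.2 →
      (reduce t n x).1 * E = evalL yv (reduce t n x).2
  | 0, x, hx => hx
  | n + 1, (mult, row), hx => by
      unfold reduce
      cases hf : findFact t row with
      | none => simpa using hx
      | some uf =>
          rcases uf with ⟨u, d, co⟩
          apply reduce_sound ht E n
          have hfact := ht u (d, co) (findFact_get t row u (d, co) hf)
          simp only at hx hfact ⊢
          rw [evalL_mergeL, evalL_scaleL, evalL_scaleL, ← hfact]
          have hsplit := evalL_eraseKey yv row u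
          calc mult * d * E = d * (mult * E) := by ring
            _ = d * evalL yv row := by rw [hx]
            _ = d * evalL yv (eraseKey row u) + coefOf row u * (d * yv u) := by rw [hsplit]; ring

/-- One step keeps a sound table sound, provided its equation holds. [folklore] -/
theorem doStep_sound {t t' : Table} (ht : ∀ u f, Table.get t u = some f → f.1 * yv u = evalL yv f.2)
    (eq : List (ℕ × ℤ)) (heq : evalL yv eq = 0) (u : ℕ) (h : doStep t eq u = some t') :
    ∀ v g, Table.get t' v = some g → g.1 * yv v = evalL yv g.2 := by
  unfold doStep at h
  simp only at h
  split_ifs at h with hc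
  simp only [Option.some.injEq] at h
  subst h
  apply Table.sound_set yv ht
  -- the reduced equation evaluates to `0`
  have hred := reduce_sound yv ht (0 : ℤ) 64 (1, mergeL [] eq) (by simp [evalL_mergeL, heq])
  simp only [mul_zero] at hred
  have hsplit := evalL_eraseKey yv (reduce t 64 (1, mergeL [] eq)).2 u
  simp only
  rw [evalL_scaleL]
  linarith

/-- The equation decoded from a packed step. [folklore] -/
def stepEq (n : ℕ) : List (ℕ × ℤ) :=
  eqTermsN (n / 4900 / 4096 / 5 / 512) ((n / 4900 / 4096 / 5) % 512)
    (keyN (fun a => kd (n / 4900 / 4096 / 5 / 512) (sA ((n / 4900 / 4096) % 5) a))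
      (fun i => wd ((n / 4900) % 4096) i))

/-- `runStep` is `doStep` on the decoded equation and target. [folklore] -/
theorem runStep_eq (t : Table) (n : ℕ) : runStep t n = doStep t (stepEq n) (stepTarget n) := rfl

/-- Running steps whose equations hold keeps a sound table sound. [folklore] -/
theorem runSteps_sound : ∀ (steps : List ℕ) (t t' : Table), (∀ n ∈ steps, evalL yv (stepEq n) = 0) →
    (∀ u f, Table.get t u = some f → f.1 * yv u = evalL yv f.2) → runSteps t steps = some t' →
    ∀ u f, Table.get t' u = some f → f.1 * yv u = evalL yv f.2
  | [], t, t', _, ht, h => by simp [runSteps] at h; subst h; exact ht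
  | n :: l, t, t', hst, ht, h => by
      unfold runSteps at h
      rw [runStep_eq] at h
      cases hs : doStep t (stepEq n) (stepTarget n) with
      | none => rw [hs] at h; simp at h
      | some t₁ =>
          rw [hs] at h
          exact runSteps_sound l t₁ t' (fun k hk => hst k (List.mem_cons_of_mem _ hk))
            (doStep_sound yv ht (stepEq n) (hst n List.mem_cons_self) (stepTarget n) hs) h

/-- The table of a list of true facts is sound. [folklore] -/
theorem ofFacts_sound (l : List (ℕ × Fact)) (hl : ∀ p ∈ l, p.2.1 * yv p.1 = evalL yv p.2.2) :
    ∀ u f, Table.get (Table.ofFacts l) u = some f → f.1 * yv u = evalL yv f.2 := by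
  unfold Table.ofFacts
  suffices h : ∀ (l : List (ℕ × Fact)) (t : Table), (∀ p ∈ l, p.2.1 * yv p.1 = evalL yv p.2.2) →
      (∀ u f, Table.get t u = some f → f.1 * yv u = evalL yv f.2) →
      ∀ u f, Table.get (l.foldl (fun t p => t.set p.1 p.2) t) u = some f → f.1 * yv u = evalL yv f.2 from
    h l emptyTable hl (emptyTable_sound yv)
  intro l
  induction l with
  | nil => intro t _ ht; simpa using ht
  | cons p l ih =>
      intro t hl ht
      rw [List.foldl_cons]
      exact ih _ (fun q hq => hl q (List.mem_cons_of_mem _ hq))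
        (Table.sound_set yv ht p.1 p.2 (hl p List.mem_cons_self))

/-- Facts read back verbatim from a sound table hold. [folklore] -/
theorem has_true {t : Table} (ht : ∀ u f, Table.get t u = some f → f.1 * yv u = evalL yv f.2)
    (l : List (ℕ × Fact)) (h : t.has l = true) : ∀ p ∈ l, p.2.1 * yv p.1 = evalL yv p.2.2 := by
  intro p hp
  unfold Table.has at h
  rw [List.all_eq_true] at h
  have := h p hp
  simp only [decide_eq_true_eq] at this
  exact ht p.1 p.2 this

/-- The resolved value of the unknown `u`: `B₀ (yv 0 + yv 14) - B₁ yv 14 - B₂ yv 4` with `B = basisN`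
at `u` (the values of `θ₄, Re w, Im w`). [folklore] -/
def relRHS (u : ℕ) : ℤ :=
  (basisN (sortedWords.getD (u / 70) []) (sortedWords.getD (u % 70) [])).1 * (yv 0 + yv 14) -
    (basisN (sortedWords.getD (u / 70) []) (sortedWords.getD (u % 70) [])).2.1 * yv 14 -
    (basisN (sortedWords.getD (u / 70) []) (sortedWords.getD (u % 70) [])).2.2 * yv 4

/-- The final check pins down `yv u`. [folklore] -/
theorem finalOne_sound {t : Table} (ht : ∀ u f, Table.get t u = some f → f.1 * yv u = evalL yv f.2)
    (u : ℕ) (h : finalOne t u = true) : yv u = relRHS yv u := by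
  unfold finalOne at h
  simp only [Bool.and_eq_true, decide_eq_true_eq, List.all_eq_true] at h
  obtain ⟨⟨⟨⟨hD, hsupp⟩, h0⟩, h4⟩, h14⟩ := h
  set DR := reduce t 64 (1, [(u, 1)]) with hDR
  set B := basisN (sortedWords.getD (u / 70) []) (sortedWords.getD (u % 70) []) with hB
  have hred := reduce_sound yv ht (yv u) 64 (1, [(u, 1)]) (by simp)
  rw [← hDR] at hred
  have hev := evalL_of_support yv DR.2 (fun q hq => hsupp q hq)
  rw [hev, h0, h4, h14] at hred
  unfold relRHS
  rw [← hB]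
  have hD' : DR.1 ≠ 0 := hD
  have key : DR.1 * yv u = DR.1 * (B.1 * (yv 0 + yv 14) - B.2.1 * yv 14 - B.2.2 * yv 4) := by
    rw [hred]; ring
  exact mul_left_cancel₀ hD' key

/-- **Soundness of one certificate chunk**: if every equation of the chunk evaluates to `0` and the
incoming facts hold, then the outgoing facts hold and every unknown of the final list satisfies the
resolved relation. [folklore] -/
theorem checkChunk_sound (factsIn : List (ℕ × Fact)) (steps : List ℕ) (factsOut : List (ℕ × Fact))
    (finals : List ℕ) (hst : ∀ n ∈ steps, evalL yv (stepEq n) = 0)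
    (hIn : ∀ p ∈ factsIn, p.2.1 * yv p.1 = evalL yv p.2.2)
    (h : checkChunk factsIn steps factsOut finals = true) :
    (∀ p ∈ factsOut, p.2.1 * yv p.1 = evalL yv p.2.2) ∧ ∀ u ∈ finals, yv u = relRHS yv u := by
  unfold checkChunk at h
  cases hr : runSteps (Table.ofFacts factsIn) steps with
  | none => rw [hr] at h; simp at h
  | some t =>
      rw [hr] at h
      simp only [Bool.and_eq_true, List.all_eq_true] at h
      have ht := runSteps_sound yv steps _ t hst (ofFacts_sound yv factsIn hIn) hr
      exact ⟨has_true yv ht factsOut h.1, fun u hu => finalOne_sound yv ht u (h.2 u hu)⟩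

end Sound

end Chk

end Summit.HodgeConjecture.HodgeConjecture.Theorems.TropicalHodgeBound
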